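import Summits.Langlands.Langlands.Theorems.ParityBlindBianchiTwoAdicBianchiProModularityLevelSqueezeDefs
import Literature.NumberTheory.GaloisRepresentations.IntegralGaloisAction
import HarnessLib

/-!
# Route `ParityBlindBianchi`, crux `TwoAdicBianchiProModularityLevel` (stmt-Langlands-15110): vocabulary of the
# line `dimension-squeeze`, part 2 (v3) — loci of an arbitrary ideal and Kisin's component choice

Companion of the landed Defs file `ParityBlindBianchiTwoAdicBianchiProModularityLevelSqueezeDefs.lean` (p137908;
D-0016 `<Route><Crux>Defs` convention; same namespace as the checked skeleton
`Cruxes/TwoAdicBianchiProModularityLevel/Lines/dimension_squeeze.lean`).  NOTHING IS ASSERTED: definitions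
(`Model.pointsOf`, `Model.locusOf`, `Model.heckePointsOf`, `Model.heckeIdealOf`, `Model.InertiaNonabelianAt`,
`Model.typeIdealD`) consumed only in the types of the registered v3 stubs, `rfl` bridges to the v2 objects, order
lemmas, and the registered sub-goal `squeeze_locusOf_le_heckeIdealOf`.

WHY (the two refutations of GAL, `Lines/dimension-squeeze-GALv1-false.md`, `…-GALv2-false.md`): the Galois stub of
the squeeze asks the Zariski closure of the characteristic-`0` type-`θ` deformations to be IRREDUCIBLE; v1 (naive
`σ`-minimality) and v2 (inertial traces) both left a finite invariant free — the inertial trace type, resp. the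
unramified-twist sign `μ = ±1` at an odd bad place with absolutely irreducible inertia type — realised with both
values by `x_σ` and a quadratic twist `x_{σ⊗χ}`.  v3 pins the DECOMPOSITION traces at exactly those places (Kisin's
component choice; costless, the local typed fibre being `0`-dimensional modulo framing) and, to make any further
repair of this kind a one-line change, states everything for an ARBITRARY ideal `I` of `R`.

References: KisinModuli2009 §2.3; the line card `Cruxes/TwoAdicBianchiProModularityLevel/Lines/dimension-squeeze.md`.
-/

noncomputable section

set_option linter.dupNamespace false -- `Summit.Langlands.Langlands` is the mandated namespace (D-0017)

open scoped NumberField MatrixGroups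
open Polynomial IsDedekindDomain Field
open Literature.NumberTheory.GaloisRepresentations Literature.NumberTheory.Automorphic

namespace Summit.Langlands.Langlands.Cruxes.TwoAdicBianchiProModularityLevel.DimensionSqueeze

/-! ### v3 (lead c14, after the GAL-v2 refutation): loci of an arbitrary ideal, and the component choice

`stub_galoisDomain` v2 is false as well (`Lines/dimension-squeeze-GALv2-false.md`, GAL stub-worker): at an odd bad
place whose inertia type `τ = σ|_{I_w}` is absolutely irreducible (non-abelian inertia image, wild at `3` or `5`), every
type point is `σ|_{D_w} ⊗ μ` with `μ` unramified, `μ² = 1`, and both signs occur (unramified quadratic twist), so the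
type locus has two components there.  Kisin's remedy is a COMPONENT CHOICE: also pin the traces on the
DECOMPOSITION group at those places (costless: the local typed fibre is `0`-dimensional modulo framing), and nowhere
else.  To make further repairs of this kind cheap, the loci are now defined for an ARBITRARY ideal `I` of `R`
(`pointsOf`, `locusOf`, `heckePointsOf`, `heckeIdealOf`; the v2 objects are the case `I = typeIdeal`, by `rfl`),
and the v3 stubs are their instances at `I = typeIdealD`. -/

namespace Model

variable {K : Type} [Field K] [NumberField K] {σ : FramedGaloisRep K (PadicAlgCl 2) 2} (M : Model σ)
variable {S₀ : Finset ℕ} {h0 : (0 : ℕ) ∉ S₀} {h2 : 2 ∈ S₀}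
  {hunr : ∀ v ∉ badSet K S₀, Deformation.IsUnramifiedAt v M.residual}

/-- The `𝒪`-algebra points `φ : R → 𝒪_{ℚ̄₂}` (restricting to the fixed embedding on `𝒪`) killing the
ideal `I`: the characteristic-`0` points of `V(I) ⊆ Spec R`. [folklore] -/
def pointsOf (𝓡 : PolarizedDeformationRing (M.datum S₀ h0 h2 hunr)) (I : Ideal 𝓡.R) : Set (𝓡.R →+* O2) :=
  {φ | φ.comp (algebraMap M.𝒪 𝓡.R) = M.emb ∧ I ≤ RingHom.ker φ}

/-- The ideal of the Zariski closure of the characteristic-`0` points of `V(I)` (the reduced,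
`2`-torsion-free "`𝒪`-flat closure" of `R ⧸ I`). [folklore] -/
def locusOf (𝓡 : PolarizedDeformationRing (M.datum S₀ h0 h2 hunr)) (I : Ideal 𝓡.R) : Ideal 𝓡.R :=
  ⨅ φ ∈ M.pointsOf 𝓡 I, RingHom.ker φ

/-- The HECKE points among the points of `V(I)` at tame level `U`: those whose Galois representation
`φ ∘ ρ^univ` is Hansen-associated at every good place with a point of `Spf 𝕋(U²)` of the `2`-power
Bianchi tower. [cite: HansenUniversalEigenvarieties2017, Def. 1.2.1] -/
def heckePointsOf (𝓡 : PolarizedDeformationRing (M.datum S₀ h0 h2 hunr)) (I : Ideal 𝓡.R)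
    (U : Subgroup (GL (Fin 2) (FiniteAdeleRing (𝓞 K) K)))
    (ϖ : ∀ v : HeightOneSpectrum (𝓞 K), (v.adicCompletion K)ˣ) : Set (𝓡.R →+* O2) :=
  {φ | φ ∈ M.pointsOf 𝓡 I ∧
    ∃ b : Good K S₀ → ℕ → O2,
      (∀ (v : HeightOneSpectrum (𝓞 K)) (hv : ∀ ℓ ∈ S₀, ((ℓ : ℕ) : 𝓞 K) ∉ v.asIdeal),
        IsAssocBare K (M.pointRep 𝓡 φ) v
          (fun i : ℕ => if i = 0 then (1 : PadicAlgCl 2) else (b ⟨v, hv⟩ i : PadicAlgCl 2))) ∧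
      IsPointAt K S₀ U ϖ b}

/-- The ideal of the Zariski closure of the Hecke points of `V(I)` at level `U`. [folklore] -/
def heckeIdealOf (𝓡 : PolarizedDeformationRing (M.datum S₀ h0 h2 hunr)) (I : Ideal 𝓡.R)
    (U : Subgroup (GL (Fin 2) (FiniteAdeleRing (𝓞 K) K)))
    (ϖ : ∀ v : HeightOneSpectrum (𝓞 K), (v.adicCompletion K)ˣ) : Ideal 𝓡.R :=
  ⨅ φ ∈ M.heckePointsOf 𝓡 I U ϖ, RingHom.ker φ

/-- The v2 type points are the points of `V(typeIdeal)`. [folklore] -/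
theorem typePoints_eq_pointsOf (𝓡 : PolarizedDeformationRing (M.datum S₀ h0 h2 hunr)) :
    M.typePoints 𝓡 = M.pointsOf 𝓡 (M.typeIdeal 𝓡) := rfl

/-- The v2 type locus ideal is `locusOf typeIdeal`. [folklore] -/
theorem typeLocusIdeal_eq_locusOf (𝓡 : PolarizedDeformationRing (M.datum S₀ h0 h2 hunr)) :
    M.typeLocusIdeal 𝓡 = M.locusOf 𝓡 (M.typeIdeal 𝓡) := rfl

/-- The v2 Hecke points are `heckePointsOf typeIdeal`. [folklore] -/
theorem heckePoints_eq_heckePointsOf (𝓡 : PolarizedDeformationRing (M.datum S₀ h0 h2 hunr))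
    (U : Subgroup (GL (Fin 2) (FiniteAdeleRing (𝓞 K) K)))
    (ϖ : ∀ v : HeightOneSpectrum (𝓞 K), (v.adicCompletion K)ˣ) :
    M.heckePoints 𝓡 U ϖ = M.heckePointsOf 𝓡 (M.typeIdeal 𝓡) U ϖ := rfl

/-- The v2 Hecke ideal is `heckeIdealOf typeIdeal`. [folklore] -/
theorem heckeIdeal_eq_heckeIdealOf (𝓡 : PolarizedDeformationRing (M.datum S₀ h0 h2 hunr))
    (U : Subgroup (GL (Fin 2) (FiniteAdeleRing (𝓞 K) K)))
    (ϖ : ∀ v : HeightOneSpectrum (𝓞 K), (v.adicCompletion K)ˣ) :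
    M.heckeIdeal 𝓡 U ϖ = M.heckeIdealOf 𝓡 (M.typeIdeal 𝓡) U ϖ := rfl

/-- Hecke points of `V(I)` are points of `V(I)`. [folklore] -/
theorem heckePointsOf_subset_pointsOf (𝓡 : PolarizedDeformationRing (M.datum S₀ h0 h2 hunr)) (I : Ideal 𝓡.R)
    (U : Subgroup (GL (Fin 2) (FiniteAdeleRing (𝓞 K) K)))
    (ϖ : ∀ v : HeightOneSpectrum (𝓞 K), (v.adicCompletion K)ˣ) :
    M.heckePointsOf 𝓡 I U ϖ ⊆ M.pointsOf 𝓡 I := fun _ hφ => hφ.1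

/-- `locusOf I ≤ heckeIdealOf I U`: the closure of the Hecke points lies in the locus. [folklore] -/
theorem locusOf_le_heckeIdealOf (𝓡 : PolarizedDeformationRing (M.datum S₀ h0 h2 hunr)) (I : Ideal 𝓡.R)
    (U : Subgroup (GL (Fin 2) (FiniteAdeleRing (𝓞 K) K)))
    (ϖ : ∀ v : HeightOneSpectrum (𝓞 K), (v.adicCompletion K)ˣ) :
    M.locusOf 𝓡 I ≤ M.heckeIdealOf 𝓡 I U ϖ :=
  le_iInf₂ fun φ hφ => iInf₂_le φ (M.heckePointsOf_subset_pointsOf 𝓡 I U ϖ hφ)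

/-- `I ≤ locusOf I`. [folklore] -/
theorem le_locusOf (𝓡 : PolarizedDeformationRing (M.datum S₀ h0 h2 hunr)) (I : Ideal 𝓡.R) :
    I ≤ M.locusOf 𝓡 I :=
  le_iInf₂ fun _ hφ => hφ.2

/-- Points are antitone in the ideal. [folklore] -/
theorem pointsOf_mono {𝓡 : PolarizedDeformationRing (M.datum S₀ h0 h2 hunr)} {I J : Ideal 𝓡.R} (h : I ≤ J) :
    M.pointsOf 𝓡 J ⊆ M.pointsOf 𝓡 I := fun _ hφ => ⟨hφ.1, h.trans hφ.2⟩

/-- The locus ideal is monotone in the ideal. [folklore] -/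
theorem locusOf_mono {𝓡 : PolarizedDeformationRing (M.datum S₀ h0 h2 hunr)} {I J : Ideal 𝓡.R} (h : I ≤ J) :
    M.locusOf 𝓡 I ≤ M.locusOf 𝓡 J :=
  le_iInf₂ fun φ hφ => iInf₂_le φ (M.pointsOf_mono h hφ)

/-- **`σ` has non-abelian inertia image at `𝔓`** — equivalently (finite image, characteristic `0`) the
inertia type `σ|_{I_𝔓}` is absolutely irreducible: the places where the unramified-twist sign of a type point
is a discrete invariant (`Lines/dimension-squeeze-GALv2-false.md`). [folklore] -/
def InertiaNonabelianAt (𝔓 : Ideal (absIntegers (𝓞 K) K)) : Prop :=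
  ∃ g ∈ 𝔓.inertia (absoluteGaloisGroup K), ∃ h ∈ 𝔓.inertia (absoluteGaloisGroup K),
    M.σ𝒪 g * M.σ𝒪 h ≠ M.σ𝒪 h * M.σ𝒪 g

open scoped Pointwise in
/-- **The type ideal with Kisin's component choice** (v3): `typeIdeal` (fixed determinant, `σ`-minimality and
inertial traces at the odd bad places) plus the DECOMPOSITION-group traces `tr ρ^univ(g) − tr σ_𝒪(g)`, `g ∈ D_𝔓`,
at the odd bad places `𝔓` where the inertia image of `σ` is non-abelian (there every type point is
`σ|_{D_𝔓} ⊗ μ`, `μ = ±1` unramified, and this pins `μ = 1`; it costs no dimension).  Nothing at the places over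
`2`; no decomposition traces where the inertia type is reducible. [cite: KisinModuli2009, §2.3] -/
def typeIdealD (𝓡 : PolarizedDeformationRing (M.datum S₀ h0 h2 hunr)) : Ideal 𝓡.R :=
  M.typeIdeal 𝓡 ⊔ Ideal.span
    {x | ∃ (v : HeightOneSpectrum (𝓞 K)) (𝔓 : Ideal (absIntegers (𝓞 K) K)) (g : absoluteGaloisGroup K),
      v ∈ badSet K S₀ ∧ ((2 : ℕ) : 𝓞 K) ∉ v.asIdeal ∧ 𝔓 ∈ v.primesAbove ∧ M.InertiaNonabelianAt 𝔓 ∧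
      g ∈ 𝔓.decompositionSubgroup (absoluteGaloisGroup K) ∧
      x = ((𝓡.ρ g : GL (Fin 2) 𝓡.R) : Matrix (Fin 2) (Fin 2) 𝓡.R).trace -
        algebraMap M.𝒪 𝓡.R ((M.σ𝒪 g : GL (Fin 2) M.𝒪) : Matrix (Fin 2) (Fin 2) M.𝒪).trace}

/-- `typeIdeal ≤ typeIdealD`. [folklore] -/
theorem typeIdeal_le_typeIdealD (𝓡 : PolarizedDeformationRing (M.datum S₀ h0 h2 hunr)) :
    M.typeIdeal 𝓡 ≤ M.typeIdealD 𝓡 := le_sup_left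

end Model

/-- REGISTERED SUB-GOAL `squeeze_locusOf_le_heckeIdealOf` (generic form of the order relation used by the
composition): `locusOf I ≤ heckeIdealOf I U` for every ideal `I`. [folklore] -/
theorem squeeze_locusOf_le_heckeIdealOf : ∀ (K : Type) [Field K] [NumberField K]
    (σ : FramedGaloisRep K (PadicAlgCl 2) 2) (M : Model σ) (S₀ : Finset ℕ) (h0 : (0 : ℕ) ∉ S₀) (h2 : 2 ∈ S₀)
    (hunr : ∀ v ∉ badSet K S₀, Deformation.IsUnramifiedAt v M.residual)
    (𝓡 : PolarizedDeformationRing (M.datum S₀ h0 h2 hunr)) (I : Ideal 𝓡.R)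
    (U : Subgroup (GL (Fin 2) (FiniteAdeleRing (𝓞 K) K)))
    (ϖ : ∀ v : HeightOneSpectrum (𝓞 K), (v.adicCompletion K)ˣ),
    M.locusOf 𝓡 I ≤ M.heckeIdealOf 𝓡 I U ϖ :=
  fun _ _ _ _ M _ _ _ _ 𝓡 I U ϖ => M.locusOf_le_heckeIdealOf 𝓡 I U ϖ

end Summit.Langlands.Langlands.Cruxes.TwoAdicBianchiProModularityLevel.DimensionSqueeze

end
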